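import Literature.NumberTheory.EllipticCurves.ComplexMultiplicationCoatesWiles
import Literature.NumberTheory.EllipticCurves.MordellWeilRankZeroProofs
import Literature.NumberTheory.EllipticCurves.LeadingTerm
import Literature.NumberTheory.EllipticCurves.PAdicBSD
import HarnessLib

/-!
# Coates–Wiles (1977) for `E/ℚ` below Gross–Zagier–Kolyvagin and Kato

Topic `NumberTheory/EllipticCurves`; proof sibling (theorems only: no definition, no named fact,
no instance) of `Literature/NumberTheory/EllipticCurves/ComplexMultiplicationCoatesWiles.lean`,
serving the named fact `Literature.NumberTheory.EllipticCurves.CoatesWiles1977_L_one_div_period_mem_prime`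
(Coates–Wiles, Invent. Math. 39 (1977), §6 p. 250: a rational point of infinite order on a CM
curve `E/ℚ` with `j(E) ∈ maximalCMJInvariants` forces `𝔭 ∣ Ω⁻¹ L(E/ℚ, 1)` for every good,
split, non-anomalous `p > 7` and `𝔭 ∣ p`).

## What is proved here

The tree isolates three mutually reducible named facts for the Mordell–Weil part of BSD in the
CM case (bsd.S28):

* `CoatesWiles1977_L_one_div_period_mem_prime` — the per-prime `𝔭`-divisibility (CW §6, p. 250);
* `CoatesWiles1977_L_one_eq_zero_of_not_isOfFinAddOrder` — Theorem 1 for `F = ℚ` as printed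
  (CW p. 223: a point of infinite order forces `L(E/ℚ, 1) = 0`);
* `finite_point_of_j_mem_maximalCMJInvariants_of_L_one_ne_zero` — bsd.S28, Mordell–Weil part
  (`L(E, 1) ≠ 0 ⇒ E(ℚ)` finite),

with the reductions Theorem 1 `⇐` per-prime fact (+ `L = Ω𝓞`, + Deuring resp. Schur:
`CoatesWiles1977_L_one_eq_zero_of_not_isOfFinAddOrder_of_facts`, `…_of_mem_prime`) and
Theorem 1 `⇔` bsd.S28 (`finite_point_of_j_mem_maximalCMJInvariants_of_L_one_ne_zero_iff_CoatesWiles1977`,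
using the proved Mordell–Weil theorem `WeierstrassCurve.module_finite_point_holds`) already
proved. This file adds, sorry-free:

1. `CoatesWiles1977_L_one_div_period_mem_prime_of_L_one_eq_zero` — **per-prime fact `⇐`
   Theorem 1**, closing the circle: design note (4) of `ComplexMultiplicationCoatesWiles.lean`
   ("as a bare proposition, a consequence of Theorem 1 itself: once `L(E/ℚ, 1) = 0` take `a = 0`,
   `b = 1`") made formal. Hence all three facts are equivalent over the tree (given `L = Ω𝓞_K`,
   `exists_isCMPeriod_of_j_mem_maximalCMJInvariants`, for the step per-prime `⇒` Theorem 1).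
2. `finite_point_of_entireLFunction_one_ne_zero_of_GrossZagierKolyvagin` — for **every** elliptic
   curve `E/ℚ`: the named fact bsd.S17 `rank_eq_analyticRank_of_analyticRank_le_one`
   (Gross–Zagier–Kolyvagin with modularity; Darmon, CBMS 101, Thm. 1.14 = Thm. 3.22: *"(1) If
   `L(E, 1) ≠ 0`, then `#E(ℚ) < ∞`, i.e., `r = 0`"*) gives `L(E, 1) ≠ 0 ⇒ E(ℚ)` finite, via
   `r_an = 0` (`analyticRank_eq_zero_of_entireLFunction_one_ne_zero`, unconditional), `rank = r_an`
   (bsd.S17) and `rank = 0 ⇔ E(ℚ)` finite (`WeierstrassCurve.mordellWeilRank_eq_zero_iff_finite`,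
   the proved Mordell–Weil theorem + structure of finitely generated abelian groups).
3. Consequently **each of the three CM facts, and the geometric-CM form
   `finite_point_of_hasCM_of_L_one_ne_zero` of bsd.S28, follows from bsd.S17 alone**
   (`…_of_GrossZagierKolyvagin`), and likewise from Kato's finiteness theorem
   `kato_finite_of_L_one_ne_zero` (Astérisque 295, Cor. 14.3: `L(E,1) ≠ 0 ⇒ E(ℚ)` finite, no
   Heegner points) (`…_of_Kato`).

This is an honest but *anachronistic* upstream: Coates–Wiles (1977) predates modularity,
Gross–Zagier (1986), Kolyvagin (1990) and Kato (2004), and their `𝔭`-adic argument (elliptic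
units, Lubin–Tate towers, local and global class field theory, the Kronecker limit formula at
`s = k`; Rubin, LNM 1716, §§5–10) is formalised nowhere in the tree or in Mathlib. The theorems
below record precisely that, *as propositions*, the CM leaves of bsd.S28 add nothing to the trust
base beyond bsd.S17 (or Kato): whoever discharges `rank_eq_analyticRank_of_analyticRank_le_one`
discharges `CoatesWiles1977_L_one_div_period_mem_prime` by
`CoatesWiles1977_L_one_div_period_mem_prime_of_GrossZagierKolyvagin`.

| implication | Lean declaration | status |
|---|---|---|
| CW Thm 1 (`F = ℚ`) ⇒ CW §6 p. 250 per-prime statement | `CoatesWiles1977_L_one_div_period_mem_prime_of_L_one_eq_zero` | proved |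
| bsd.S17 ⇒ (`L(E,1) ≠ 0 ⇒ E(ℚ)` finite), all `E/ℚ` (Darmon Thm. 1.14 (1)) | `finite_point_of_entireLFunction_one_ne_zero_of_GrossZagierKolyvagin` | proved |
| bsd.S17 ⇒ bsd.S28 (maximal order; geometric CM) | `finite_point_of_j_mem_maximalCMJInvariants_of_L_one_ne_zero_of_GrossZagierKolyvagin`, `finite_point_of_hasCM_of_L_one_ne_zero_of_GrossZagierKolyvagin` | proved |
| bsd.S17 ⇒ CW Thm 1 (`F = ℚ`) | `CoatesWiles1977_L_one_eq_zero_of_not_isOfFinAddOrder_of_GrossZagierKolyvagin` | proved |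
| bsd.S17 ⇒ CW per-prime fact | `CoatesWiles1977_L_one_div_period_mem_prime_of_GrossZagierKolyvagin` | proved |
| Kato Cor. 14.3 ⇒ the same four statements | `…_of_Kato` | proved |

## References

* J. Coates, A. Wiles, *On the conjecture of Birch and Swinnerton-Dyer*, Invent. Math. 39 (1977),
  223–251: Thm. 1 (p. 223) and the proof of Thm. 1, §6 (pp. 250–251). [CoatesWiles1977]
* H. Darmon, *Rational Points on Modular Elliptic Curves*, CBMS 101, AMS (2004): Thm. 1.14
  (Ch. 1, p. 9 of the author's edition) = Thm. 3.22 (§3.9). [Darmon2004]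
* K. Kato, *`p`-adic Hodge theory and values of zeta functions of modular forms*, Astérisque 295
  (2004), 117–290: Thm. 14.2 and Cor. 14.3 (p. 235). [Kato2004Asterisque]
* J. H. Silverman, *The Arithmetic of Elliptic Curves*, 2nd ed., GTM 106 (2009): Thm. VIII.6.7
  (Mordell–Weil). [SilvermanAEC2009]
-/

open scoped Classical

open WeierstrassCurve

namespace Literature.NumberTheory.EllipticCurves

/-! ### The per-prime statement of Coates–Wiles §6 below Theorem 1 -/

/-- **Coates–Wiles' per-prime divisibility follows from their Theorem 1 (`F = ℚ`).** If a
rational point of infinite order on `E/ℚ` with `j(E) ∈ maximalCMJInvariants` forces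
`L(E/ℚ, 1) = 0` (hypothesis `h`, the named fact
`CoatesWiles1977_L_one_eq_zero_of_not_isOfFinAddOrder`: Coates–Wiles, Invent. Math. 39 (1977),
Thm. 1, p. 223), then under the hypotheses of `CoatesWiles1977_L_one_div_period_mem_prime`
(§6, p. 250) one has `L(E/ℚ, 1) · b = Ω · a` with `a = 0 ∈ 𝔭` and `b = 1 ∉ 𝔭` (`𝔭` is a prime,
hence proper, ideal). This is design note (4) of `ComplexMultiplicationCoatesWiles.lean`: as a
bare proposition the per-prime statement is not stronger than Theorem 1; its content is the
`𝔭`-adic argument of pp. 225–250, which proves it one prime at a time *without* Dirichlet's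
theorem and the closing norm argument of p. 251.
[cite: CoatesWiles1977, Thm. 1 (p. 223) and §6 p. 250] -/
theorem CoatesWiles1977_L_one_div_period_mem_prime_of_L_one_eq_zero
    (h : CoatesWiles1977_L_one_eq_zero_of_not_isOfFinAddOrder) :
    CoatesWiles1977_L_one_div_period_mem_prime := by
  intro W _ _ hj Ω _ P hP p _ _ _ _ _ _ 𝔭 h𝔭 _
  refine ⟨0, 1, 𝔭.zero_mem, (Ideal.ne_top_iff_one 𝔭).1 h𝔭.ne_top, ?_⟩
  simp [h W hj P hP]

/-! ### Below Gross–Zagier–Kolyvagin (bsd.S17) -/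

/-- **Gross–Zagier–Kolyvagin, analytic rank zero: `L(E, 1) ≠ 0 ⇒ E(ℚ)` is finite**, for every
elliptic curve `E/ℚ` (Darmon, CBMS 101, Thm. 1.14 (1): *"If `L(E, 1) ≠ 0`, then `#E(ℚ) < ∞`,
i.e., `r = 0`"*), derived from the tree's named fact bsd.S17
`rank_eq_analyticRank_of_analyticRank_le_one` (Darmon Thm. 3.22: `ord_{s=1} L(E,s) ≤ 1 ⇒
rank E(ℚ) = ord_{s=1} L(E,s)`, hypothesis `h`): `L(E,1) ≠ 0` gives `r_an = 0`
unconditionally (`analyticRank_eq_zero_of_entireLFunction_one_ne_zero`), so `rank_ℤ E(ℚ) = 0`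
by `h`, and `rank_ℤ E(ℚ) = 0 ⇔ E(ℚ)` finite is the proved
`WeierstrassCurve.mordellWeilRank_eq_zero_iff_finite` (Mordell–Weil, Silverman AEC
Thm. VIII.6.7, `module_finite_point_holds`, with the structure theorem of finitely generated
abelian groups). [cite: Darmon2004, Thm. 1.14 (1) (Ch. 1 p. 9) = Thm. 3.22 (§3.9)]
[cite: SilvermanAEC2009, Thm. VIII.6.7] -/
theorem finite_point_of_entireLFunction_one_ne_zero_of_GrossZagierKolyvagin
    (h : rank_eq_analyticRank_of_analyticRank_le_one) (W : WeierstrassCurve ℚ) [W.IsElliptic]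
    (hL : W.entireLFunction 1 ≠ 0) : Finite W.toAffine.Point := by
  have h0 : W.analyticRank = 0 := analyticRank_eq_zero_of_entireLFunction_one_ne_zero W hL
  have hr : W.mordellWeilRank = 0 := by rw [(h W (by omega)).1, h0]
  exact W.mordellWeilRank_eq_zero_iff_finite.1 hr

/-- **bsd.S28 (Mordell–Weil part, maximal-order CM) from bsd.S17.** The named fact
`finite_point_of_j_mem_maximalCMJInvariants_of_L_one_ne_zero` (Coates–Wiles 1977, Thm. 1 read
against Mordell–Weil: `E/ℚ` with `j(E) ∈ maximalCMJInvariants`, `L(E,1) ≠ 0 ⇒ E(ℚ)` finite)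
is the CM case of `finite_point_of_entireLFunction_one_ne_zero_of_GrossZagierKolyvagin`
(Darmon, CBMS 101, Thm. 1.14 (1), from bsd.S17, hypothesis `h`).
[cite: CoatesWiles1977, Thm. 1 (p. 223)] [cite: Darmon2004, Thm. 1.14 (1) = Thm. 3.22] -/
theorem finite_point_of_j_mem_maximalCMJInvariants_of_L_one_ne_zero_of_GrossZagierKolyvagin
    (h : rank_eq_analyticRank_of_analyticRank_le_one) :
    finite_point_of_j_mem_maximalCMJInvariants_of_L_one_ne_zero :=
  fun W _ _ hL => finite_point_of_entireLFunction_one_ne_zero_of_GrossZagierKolyvagin h W hL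

/-- **bsd.S28 (Mordell–Weil part, geometric CM) from bsd.S17.** The named fact
`finite_point_of_hasCM_of_L_one_ne_zero` (Coates–Wiles 1977 / Arthaud 1978 / Rubin 1981: `E/ℚ`
with complex multiplication, `L(E,1) ≠ 0 ⇒ E(ℚ)` finite) is the CM case of
`finite_point_of_entireLFunction_one_ne_zero_of_GrossZagierKolyvagin` (Darmon, CBMS 101,
Thm. 1.14 (1), from bsd.S17, hypothesis `h`); no isogeny-invariance input is needed on this
route. [cite: CoatesWiles1977, Thm. 1 (p. 223)] [cite: Darmon2004, Thm. 1.14 (1) = Thm. 3.22] -/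
theorem finite_point_of_hasCM_of_L_one_ne_zero_of_GrossZagierKolyvagin
    (h : rank_eq_analyticRank_of_analyticRank_le_one) :
    finite_point_of_hasCM_of_L_one_ne_zero :=
  fun W _ _ hL => finite_point_of_entireLFunction_one_ne_zero_of_GrossZagierKolyvagin h W hL

/-- **Coates–Wiles, Theorem 1 (`F = ℚ`, printed form) from bsd.S17.** A rational point of
infinite order on `E/ℚ` with `j(E) ∈ maximalCMJInvariants` forces `L(E/ℚ, 1) = 0`
(Coates–Wiles, Invent. Math. 39 (1977), Thm. 1, p. 223; the named fact
`CoatesWiles1977_L_one_eq_zero_of_not_isOfFinAddOrder`), from Gross–Zagier–Kolyvagin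
(bsd.S17, hypothesis `h`) via
`finite_point_of_j_mem_maximalCMJInvariants_of_L_one_ne_zero_of_GrossZagierKolyvagin` and the
proved equivalence with bsd.S28
(`CoatesWiles1977_L_one_eq_zero_of_not_isOfFinAddOrder_of_finite_point`: a finite group has no
element of infinite order). [cite: CoatesWiles1977, Thm. 1 (p. 223)]
[cite: Darmon2004, Thm. 1.14 (1) = Thm. 3.22] -/
theorem CoatesWiles1977_L_one_eq_zero_of_not_isOfFinAddOrder_of_GrossZagierKolyvagin
    (h : rank_eq_analyticRank_of_analyticRank_le_one) :
    CoatesWiles1977_L_one_eq_zero_of_not_isOfFinAddOrder :=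
  CoatesWiles1977_L_one_eq_zero_of_not_isOfFinAddOrder_of_finite_point
    (finite_point_of_j_mem_maximalCMJInvariants_of_L_one_ne_zero_of_GrossZagierKolyvagin h)

/-- **Coates–Wiles' per-prime divisibility (§6, p. 250) from bsd.S17.** The named fact
`CoatesWiles1977_L_one_div_period_mem_prime` — for a globally minimal `W/ℚ` with
`j(W) ∈ maximalCMJInvariants`, an `𝓞_K`-generator `Ω` of its period lattice, a rational point of
infinite order, a good split non-anomalous prime `p > 7` and a prime `𝔭 ∋ p` of `𝓞_K`:
`L(E/ℚ,1) · b = Ω · a` with `a ∈ 𝔭 ∌ b` (Coates–Wiles, Invent. Math. 39 (1977), §6 p. 250) —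
follows from Gross–Zagier–Kolyvagin (bsd.S17 `rank_eq_analyticRank_of_analyticRank_le_one`,
hypothesis `h`; Darmon, CBMS 101, Thm. 1.14 (1)) through Theorem 1
(`CoatesWiles1977_L_one_eq_zero_of_not_isOfFinAddOrder_of_GrossZagierKolyvagin`) and
`CoatesWiles1977_L_one_div_period_mem_prime_of_L_one_eq_zero`. Feeding
`rank_eq_analyticRank_of_analyticRank_le_one_holds`, once it exists, discharges the fact.
[cite: CoatesWiles1977, §6 p. 250 (proof of Thm. 1)] [cite: Darmon2004, Thm. 1.14 (1) = Thm. 3.22] -/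
theorem CoatesWiles1977_L_one_div_period_mem_prime_of_GrossZagierKolyvagin
    (h : rank_eq_analyticRank_of_analyticRank_le_one) :
    CoatesWiles1977_L_one_div_period_mem_prime :=
  CoatesWiles1977_L_one_div_period_mem_prime_of_L_one_eq_zero
    (CoatesWiles1977_L_one_eq_zero_of_not_isOfFinAddOrder_of_GrossZagierKolyvagin h)

/-! ### Below Kato (bsd.S20) -/

/-- **Kato, analytic rank zero: `L(E, 1) ≠ 0 ⇒ E(ℚ)` is finite**, for every elliptic curve
`E/ℚ`: the first clause of the tree's fact `kato_finite_of_L_one_ne_zero W p` (Kato, Astérisque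
295 (2004), Thm. 14.2 and Cor. 14.3, p. 235: for `L(A, χ, 1) ≠ 0` the `χ`-parts of `Sel(K, A)`
and `A(K)` are finite; here `A = E`, `K = ℚ`, `χ = 1`), taken at any prime, say `p = 2`
(hypothesis `h`, the fact for all `W` and `p`). Independent of Heegner points.
[cite: Kato2004Asterisque, Cor. 14.3 (p. 235)] -/
theorem finite_point_of_entireLFunction_one_ne_zero_of_Kato
    (h : ∀ (W : WeierstrassCurve ℚ) [W.IsElliptic] (p : ℕ) [Fact p.Prime],
      kato_finite_of_L_one_ne_zero W p)
    (W : WeierstrassCurve ℚ) [W.IsElliptic] (hL : W.entireLFunction 1 ≠ 0) :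
    Finite W.toAffine.Point :=
  haveI : Fact (2 : ℕ).Prime := ⟨Nat.prime_two⟩
  (h W 2 hL).1

/-- **bsd.S28 (Mordell–Weil part, maximal-order CM) from Kato's finiteness theorem**
(`kato_finite_of_L_one_ne_zero`, Astérisque 295, Cor. 14.3, hypothesis `h`), by
`finite_point_of_entireLFunction_one_ne_zero_of_Kato`. [cite: Kato2004Asterisque, Cor. 14.3 (p. 235)]
[cite: CoatesWiles1977, Thm. 1 (p. 223)] -/
theorem finite_point_of_j_mem_maximalCMJInvariants_of_L_one_ne_zero_of_Kato
    (h : ∀ (W : WeierstrassCurve ℚ) [W.IsElliptic] (p : ℕ) [Fact p.Prime],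
      kato_finite_of_L_one_ne_zero W p) :
    finite_point_of_j_mem_maximalCMJInvariants_of_L_one_ne_zero :=
  fun W _ _ hL => finite_point_of_entireLFunction_one_ne_zero_of_Kato h W hL

/-- **bsd.S28 (Mordell–Weil part, geometric CM) from Kato's finiteness theorem**
(`kato_finite_of_L_one_ne_zero`, Astérisque 295, Cor. 14.3, hypothesis `h`), by
`finite_point_of_entireLFunction_one_ne_zero_of_Kato`. [cite: Kato2004Asterisque, Cor. 14.3 (p. 235)]
[cite: CoatesWiles1977, Thm. 1 (p. 223)] -/
theorem finite_point_of_hasCM_of_L_one_ne_zero_of_Kato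
    (h : ∀ (W : WeierstrassCurve ℚ) [W.IsElliptic] (p : ℕ) [Fact p.Prime],
      kato_finite_of_L_one_ne_zero W p) :
    finite_point_of_hasCM_of_L_one_ne_zero :=
  fun W _ _ hL => finite_point_of_entireLFunction_one_ne_zero_of_Kato h W hL

/-- **Coates–Wiles, Theorem 1 (`F = ℚ`) from Kato's finiteness theorem**
(`kato_finite_of_L_one_ne_zero`, Astérisque 295, Cor. 14.3, hypothesis `h`): a point of infinite
order cannot live in the finite group `E(ℚ)` that `L(E,1) ≠ 0` would force
(`CoatesWiles1977_L_one_eq_zero_of_not_isOfFinAddOrder_of_finite_point`).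
[cite: CoatesWiles1977, Thm. 1 (p. 223)] [cite: Kato2004Asterisque, Cor. 14.3 (p. 235)] -/
theorem CoatesWiles1977_L_one_eq_zero_of_not_isOfFinAddOrder_of_Kato
    (h : ∀ (W : WeierstrassCurve ℚ) [W.IsElliptic] (p : ℕ) [Fact p.Prime],
      kato_finite_of_L_one_ne_zero W p) :
    CoatesWiles1977_L_one_eq_zero_of_not_isOfFinAddOrder :=
  CoatesWiles1977_L_one_eq_zero_of_not_isOfFinAddOrder_of_finite_point
    (finite_point_of_j_mem_maximalCMJInvariants_of_L_one_ne_zero_of_Kato h)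

/-- **Coates–Wiles' per-prime divisibility (§6, p. 250) from Kato's finiteness theorem**
(`kato_finite_of_L_one_ne_zero`, Astérisque 295, Cor. 14.3, hypothesis `h`), through Theorem 1
(`CoatesWiles1977_L_one_eq_zero_of_not_isOfFinAddOrder_of_Kato`) and
`CoatesWiles1977_L_one_div_period_mem_prime_of_L_one_eq_zero`.
[cite: CoatesWiles1977, §6 p. 250 (proof of Thm. 1)] [cite: Kato2004Asterisque, Cor. 14.3 (p. 235)] -/
theorem CoatesWiles1977_L_one_div_period_mem_prime_of_Kato
    (h : ∀ (W : WeierstrassCurve ℚ) [W.IsElliptic] (p : ℕ) [Fact p.Prime],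
      kato_finite_of_L_one_ne_zero W p) :
    CoatesWiles1977_L_one_div_period_mem_prime :=
  CoatesWiles1977_L_one_div_period_mem_prime_of_L_one_eq_zero
    (CoatesWiles1977_L_one_eq_zero_of_not_isOfFinAddOrder_of_Kato h)

end Literature.NumberTheory.EllipticCurves
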